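import Summits.RiemannHypothesis.RiemannHypothesis.Theorems.SignConeGradedFamily
import Summits.RiemannHypothesis.RiemannHypothesis.Theorems.SignConeSignConeOscillatorySmallNegativeMass

/-!
# G4 ladder-down on `SignCone.SignConeInequality` — the MASS gradation (banked sketch, fwd-ladder-RiemannHypothesis-52)

Top `X := SignConeInequality` (stmt-RiemannHypothesis-16301; `signConeInequality_iff_riemannHypothesis`).
The typed gradations of the cell (`CutoffRung`, `GapRung`, `NearCleanRung`, `FarConfinedRung`, slack, rank,
node set, verified height) all have their next rung registered or landed by other seats (see
`LADDER-SignConeInequality.md`). This file types the one gradation of `X` in its own language that was not yet a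
family: the NEGATIVE POLAR MASS budget `η`.

* `MassBoundedAt η a` — `X_a` (the item body, verbatim, Mathlib primitives) on the class of node-nonnegative
  autocorrelation sums whose negative polar mass `∫_{log 2}^{max 2a (log 2001)} s⁻(x)(e^{x/2}+e^{-x/2}) dx`
  (`s = Re F(x) + Re F(-x)`) is at most `η · Re F(0)` — ONE class hypothesis inserted, cell convention of
  `Theorems/SignConeGradedFamilyDefs.lean`;
* `MassRung η := ∀ a > 0, MassBoundedAt η a` — antitone in `η` (`massRung_anti`);
* FLOOR `massRung_nineteen_hundredths : MassRung (19/100)` — the landed bookkeeping theorem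
  `signConeOscillatory_of_negativeMass_le` (Theorems/SignConeSignConeOscillatorySmallNegativeMass.lean), node
  hypothesis UNUSED, every cutoff;
* the family reaches the top: `signConeInequality_of_forall_massRung`, `forall_massRung_iff_riemannHypothesis`;
* on-path: `massRung_of_riemannHypothesis`.

Next rung `MassRung η₁`, `η₁ > 0.1956`: the first rung of this family on which node signs / positive-definiteness
must enter (the far-field majorant's certified margin `1.1956 − 1` is exhausted: module docstring of the SmallNegativeMass
file, and `SignConeOscillatory.Negative.WithoutNodeNonneg/WithoutPD`). NOT filed as a line this cycle (C0 Attack = 1: no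
located first lemma; see LADDER md §4).
-/

noncomputable section

set_option linter.dupNamespace false

open scoped BigOperators

namespace Summit.RiemannHypothesis.RiemannHypothesis.Cruxes.SignConeInequality.MassLadder

open Summit.RiemannHypothesis.RiemannHypothesis.Theses.SignCone
open Summit.RiemannHypothesis.RiemannHypothesis.Theorems.SignCone
open Literature.NumberTheory.LFunctions

/-- `X_a` on the MASS-BOUNDED class: node-nonnegative autocorrelation sums at cutoff `a` whose negative polar mass
`∫_{log 2}^{max 2a (log 2001)} max(0, −(Re F(x) + Re F(−x)))·(e^{x/2} + e^{−x/2}) dx` is at most `η · Re F(0)`.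
(Item body of `SignConeInequality` verbatim with one class hypothesis inserted.) [folklore] -/
def MassBoundedAt (η a : ℝ) : Prop :=
  ∀ (k : ℕ) (g : Fin k → ℝ → ℂ), (∀ i, (ContDiff ℝ ((⊤ : ℕ∞) : WithTop ℕ∞) (g i) ∧ HasCompactSupport (g i)) ∧ tsupport (g i) ⊆ Set.Icc (-a) a) → let F : ℝ → ℂ := fun t => ∑ i, MeasureTheory.convolution (g i) (fun u => (starRingEnd ℂ) ((g i) (-u))) (ContinuousLinearMap.mul ℂ ℂ) MeasureTheory.MeasureSpace.volume t; (∀ n : ℕ, 2 ≤ n → 0 ≤ (F (Real.log n)).re) → (∫ x in Real.log 2..max (2 * a) (Real.log 2001), max 0 (-((F x).re + (F (-x)).re)) * (Real.exp (x / 2) + Real.exp (-(x / 2))) ≤ η * (F 0).re) → let M : ℂ → ℂ := fun s => ∫ u : ℝ, F u * Complex.exp ((s - 1 / 2) * u); -(F 0).re ≤ (M 0 + M 1 + ((1 / (2 * Real.pi) : ℂ) * (∫ t : ℝ, M (1 / 2 + t * Complex.I) * ((Complex.digamma (1 / 4 + t / 2 * Complex.I)).re : ℂ)) - F 0 * (Real.log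 Real.pi : ℂ))).re

/-- Rung `η` of the MASS ladder: `X_a` on the mass-bounded class at EVERY cutoff. [folklore] -/
def MassRung (η : ℝ) : Prop :=
  ∀ a : ℝ, 0 < a → MassBoundedAt η a

/-- **FLOOR (BC5 / F3 witness).** `MassRung (19/100)` is the landed mass-budget theorem
`signConeOscillatory_of_negativeMass_le` (far-field bookkeeping margin `0.19`; node hypothesis unused). [folklore] -/
theorem massRung_nineteen_hundredths : MassRung (19 / 100) := by
  intro a _ha k g hg F _hn hmass M
  exact signConeOscillatory_of_negativeMass_le (g := g) (F := F) rfl (fun i => (hg i).1) (fun i => (hg i).2) hmass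

/-- The family is antitone in the mass budget: a larger budget is a stronger rung. [folklore] -/
theorem massBoundedAt_anti {η η' a : ℝ} (hle : η ≤ η') (h : MassBoundedAt η' a) : MassBoundedAt η a := by
  intro k g hg F hn hmass M
  have h0 : 0 ≤ (F 0).re :=
    (abs_nonneg _).trans (abs_re_autocorrSum_le' (g := g) (F := F) rfl (fun i => (hg i).1) 0)
  exact h k g hg hn (hmass.trans (mul_le_mul_of_nonneg_right hle h0))

/-- `MassRung` is antitone in `η`. [folklore] -/
theorem massRung_anti {η η' : ℝ} (hle : η ≤ η') (h : MassRung η') : MassRung η :=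
  fun a ha => massBoundedAt_anti hle (h a ha)

/-- **On-path:** every rung follows from RH (via `signConeInequality_of_riemannHypothesis`, dropping the class
hypothesis). [folklore] -/
theorem massRung_of_riemannHypothesis (hRH : _root_.Summit.RiemannHypothesis) (η : ℝ) : MassRung η := by
  intro a ha k g hg F hn _hmass M
  exact signConeInequality_of_riemannHypothesis hRH a ha k g hg hn

/-- Dropping the class hypothesis: `X_a` gives every mass rung at cutoff `a`. [folklore] -/
theorem massBoundedAt_of_signConeAt {a : ℝ} (h : SignConeAt a) (η : ℝ) : MassBoundedAt η a := by
  intro k g hg F hn _hmass M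
  exact h k g hg hn

/-- **The family exhausts `X_a`:** if `X_a` holds on every mass-bounded class then `X_a` holds (every admissible `F`
lies in the class `η = mass(F)/Re F(0)`, or is identically zero in real part when `Re F(0) = 0`). [folklore] -/
theorem signConeAt_of_forall_massBoundedAt {a : ℝ} (h : ∀ η : ℝ, MassBoundedAt η a) : SignConeAt a := by
  intro k g hg F hn M
  have hg' : ∀ i, IsWeilTest (g i) := fun i => (hg i).1
  by_cases h0 : (F 0).re = 0
  · have hre : ∀ t : ℝ, (F t).re = 0 := fun t =>
      abs_nonpos_iff.1 (h0 ▸ abs_re_autocorrSum_le' (g := g) (F := F) rfl hg' t)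
    have hmass : (∫ x in Real.log 2..max (2 * a) (Real.log 2001),
        max 0 (-((F x).re + (F (-x)).re)) * (Real.exp (x / 2) + Real.exp (-(x / 2)))) ≤ 0 * (F 0).re := by
      simp [hre]
    exact h 0 k g hg hn hmass
  · refine h ((∫ x in Real.log 2..max (2 * a) (Real.log 2001),
        max 0 (-((F x).re + (F (-x)).re)) * (Real.exp (x / 2) + Real.exp (-(x / 2)))) / (F 0).re) k g hg hn ?_
    exact le_of_eq (div_mul_cancel₀ _ h0).symm

/-- `X ⟸ all mass rungs`. [folklore] -/
theorem signConeInequality_of_forall_massRung (h : ∀ η : ℝ, MassRung η) : SignConeInequality :=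
  signConeInequality_iff_forall_signConeAt.2 fun a ha => signConeAt_of_forall_massBoundedAt fun η => h η a ha

/-- **The top of the mass ladder is the summit**: `(∀ η, MassRung η) ↔ RH`. [folklore] -/
theorem forall_massRung_iff_riemannHypothesis : (∀ η : ℝ, MassRung η) ↔ _root_.Summit.RiemannHypothesis :=
  ⟨fun h => riemannHypothesis_of_signConeInequality (signConeInequality_of_forall_massRung h),
   fun hRH η => massRung_of_riemannHypothesis hRH η⟩

end Summit.RiemannHypothesis.RiemannHypothesis.Cruxes.SignConeInequality.MassLadder

end
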